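import Summits.Parity.GeneralizedHardyLittlewood.Theorems.GoldbachHeathBrownDispersionHeathBrownMorozUniformReduction
import HarnessLib

/-!
# Route `GoldbachHeathBrownDispersion` — support item `ShiftInvariance` (stmt-Parity-20703)

Second child of the split (gen 1) of the crux `HeathBrownMorozUniform` (stmt-Parity-19915) of route
`route-Parity-GoldbachHeathBrownDispersion` (Line C, rung F-P1b): replacing the class representatives
`(a, b) ↦ (a + dk, b + dl)` changes the class box count `residueClassPrimeCount X (log X)^(−c) d · ·`
by `o(mainTerm c σ₀ X)` (two thin slabs of width `≤ k + l` and length `≤ ηX + 1`, and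
`ηX, 1 = o(η²X²/log X)`).  This is, verbatim, the landed lemma
`Summit.Parity.GeneralizedHardyLittlewood.Theorems.GoldbachHeathBrownDispersionHeathBrownMorozUniform.isLittleO_residueClassPrimeCount_shift_sub`
(file `Theorems/GoldbachHeathBrownDispersionHeathBrownMorozUniformReduction.lean`, p536103); this file
closes the item by name.

References: D. R. Heath-Brown, B. Z. Moroz, Proc. London Math. Soc. 88 (2004) [HeathBrownMoroz2004];
D. R. Heath-Brown, Acta Math. 186 (2001) [HeathBrownActa2001].
-/

namespace Summit.Parity.GeneralizedHardyLittlewood.Theorems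

/-- **`ShiftInvariance` holds** (route `GoldbachHeathBrownDispersion`, support stmt-Parity-20703): for
`c > 0`, `σ₀ > 0`, `d > 0` and all `a b k l : ℕ`,
`π(class (a + dk, b + dl); X, (log X)^(−c)) − π(class (a, b); X, (log X)^(−c)) = o(mainTerm c σ₀ X)`
as `X → ∞`.  Proof: the landed box-shift lemma `isLittleO_residueClassPrimeCount_shift_sub` is this
statement (the hypotheses `0 < c` and `0 < d` are not even needed). [folklore] -/
theorem goldbachHeathBrownDispersion_shiftInvariance_proof :
    Summit.Parity.GeneralizedHardyLittlewood.Theses.GoldbachHeathBrownDispersion.ShiftInvariance := by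
  unfold Summit.Parity.GeneralizedHardyLittlewood.Theses.GoldbachHeathBrownDispersion.ShiftInvariance
  intro c σ₀ _ hσ₀ d a b k l _
  exact GoldbachHeathBrownDispersionHeathBrownMorozUniform.isLittleO_residueClassPrimeCount_shift_sub
    c hσ₀ d a b k l

end Summit.Parity.GeneralizedHardyLittlewood.Theorems
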